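import Summits.AnomalousDissipation.AnomalousDissipation.Theorems.BaireTransferRobustLoudUpgradeStubSteadyStratumClosed
import Summits.AnomalousDissipation.AnomalousDissipation.Theorems.WindLineWindySteadyLimitEnergy

/-!
# Stub `stub_driftWeakOfClassical` of the line `malkin-cone-group-orbits`
# (crux stmt-AnomalousDissipation-1144, lead c15 wave 3): classical steady states of ANY mean
# are drifted steady weak solutions in `V`, with budgets

A classical steady state `u` of `NS_ν(f)` on `T³` (`f` smooth) with mean `m := ∫ u` splits as
`u = m + w`, `w := u - m` smooth, divergence free and MEAN-ZERO.  Since `Dm = 0`: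
`(u·∇)u = Dw·m + (w·∇)w`, `Δu = Δw`, so `w` is a classical mean-zero steady state of `NS_ν(g)`
with the same pressure and the drifted smooth force `g := f − Dw·m`.  By the classical → weak
dictionary (`KolmogorovFloorEnsembleCeiling.Negative.exists_steadyState_of_classical`) its
`L²`-class `W ∈ V` is a steady weak solution of `NS_ν(g)`; moving the drift onto the test field
(`∫ ⟪Dw·m, φ⟫ = −∫ ⟪w, Dφ·m⟫`, antisymmetry of the trilinear form with the constant solenoidal
field `m`) gives the DRIFTED weak formulation `⟨F_{ν,f}(W), φ⟩ + ∫ ⟪Dφ(x) m, W(x)⟫ dx = 0`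
(`φ ∈ 𝒱`).  Budgets: `meanEnergy = ∫ ‖m + w‖² = ‖m‖² + ‖W‖²` (the cross term `2⟪m, ∫ w⟫`
vanishes), `meanDissipation = ν‖∇u‖² = ν‖∇w‖² = ν‖∇W‖²` (a constant only moves the zero Fourier
mode; then the a.e.-class), and `ν‖∇W‖² = (W, g) = (W, f)` (energy equation
`IsSteadyWeakSolution.energy_eq'`; `∫ ⟪w, Dw·m⟫ = 0`).  The constants bookkeeping
(`Δ(u − m) = Δu`, `div (u − m) = 0`, `∫ (u − ∫u) = 0`, `‖∇(m + w)‖ = ‖∇w‖`) is reused from the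
windy toolkit `Theorems/WindLineWindySteadyLimitEnergy.lean`.  Pure proof file (no definitions).
-/

-- `Summit.<Summit>.<Problem>` is the tree's mandated summit-side namespace (CONVENTIONS §2); for this
-- single-conjunct summit the two coincide, so the duplicate is deliberate.
set_option linter.dupNamespace false

noncomputable section

open scoped BigOperators Topology InnerProductSpace RealInnerProductSpace ENNReal
open Filter Set Function TopologicalSpace MeasureTheory

namespace Summit.AnomalousDissipation.AnomalousDissipation.Theorems.RobustLoudUpgrade.Category

open Literature.Analysis.FunctionSpaces Literature.Analysis.FunctionSpaces.Torus
open Literature.Analysis.FluidPDE Literature.Analysis.FluidPDE.Torus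
open Summit.AnomalousDissipation.AnomalousDissipation.Theses.BaireTransfer
open Summit.AnomalousDissipation.AnomalousDissipation.Theorems.DenseLoudDesignerForces
open Summit.AnomalousDissipation.AnomalousDissipation.Theorems.RobustLoudUpgrade.CensusInterior

namespace DriftWeak

/-! ## §1 A constant shift `y ↦ a y - V` and a constant drift `V` on `T^d` -/

variable {d : Type*} [Fintype d] [DecidableEq d]

omit [DecidableEq d] in
/-- `D(a - V) = Da` pointwise on `T^d` (Mathlib `fderiv_sub_const` on the re-centred lift).
[folklore] -/
theorem fderiv_sub_const_field (a : UnitAddTorus d → EuclideanSpace ℝ d) (V : EuclideanSpace ℝ d)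
    (x : UnitAddTorus d) : Torus.fderiv (fun y => a y - V) x = Torus.fderiv a x := by
  unfold Torus.fderiv liftAt
  exact fderiv_sub_const V

omit [DecidableEq d] in
/-- `∫ ‖a‖² = ‖V‖² + ∫ ‖a - V‖²` when `∫ a = V`: the cross term `2⟪V, ∫ (a - V)⟫` vanishes
(`T^d` has unit volume). [folklore] -/
theorem integral_norm_sq_eq_of_mean {a : UnitAddTorus d → EuclideanSpace ℝ d} (ha : IsSmooth a)
    {V : EuclideanSpace ℝ d} (hV : ∫ y, a y = V) :
    ∫ y, ‖a y‖ ^ 2 = ‖V‖ ^ 2 + ∫ y, ‖a y - V‖ ^ 2 := by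
  have hw : IsSmooth (fun y => a y - V) := ha.sub (isSmooth_const V)
  have h0 : ∫ y, (a y - V) = 0 := by
    have h := WindySteadyLimit.hasZeroMean_sub_integral ha.integrable
    rwa [hV] at h
  have hpt : ∀ y, ‖a y‖ ^ 2 = ‖V‖ ^ 2 + 2 * ⟪V, a y - V⟫_ℝ + ‖a y - V‖ ^ 2 := fun y => by
    rw [← norm_add_sq_real, add_sub_cancel]
  have i1 : Integrable (fun _ : UnitAddTorus d => ‖V‖ ^ 2) := integrable_const _
  have i2 : Integrable (fun y => 2 * ⟪V, a y - V⟫_ℝ) :=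
    ((isSmooth_const V).inner hw).integrable.const_mul 2
  have i12 : Integrable (fun y => ‖V‖ ^ 2 + 2 * ⟪V, a y - V⟫_ℝ) := i1.add i2
  simp_rw [hpt]
  rw [integral_add i12 hw.norm_sq.integrable, integral_add i1 i2, integral_const_mul,
    integral_inner hw.integrable, h0, inner_zero_right, mul_zero, add_zero]
  simp

/-- Moving a constant drift onto the other factor: `∫ ⟪Da(x) V, b x⟫ = -∫ ⟪a x, Db(x) V⟫` for
smooth `a`, `b` on `T^d` (antisymmetry of the trilinear form with the constant, solenoidal field
`V`, `Torus.integral_inner_convect_eq_neg`). [folklore] -/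
theorem integral_inner_fderiv_const_eq_neg {a b : UnitAddTorus d → EuclideanSpace ℝ d}
    (ha : IsSmooth a) (hb : IsSmooth b) (V : EuclideanSpace ℝ d) :
    ∫ x, ⟪Torus.fderiv a x V, b x⟫_ℝ = -∫ x, ⟪a x, Torus.fderiv b x V⟫_ℝ :=
  have hV : IsDivFree (fun _ : UnitAddTorus d => V) := fun x => by
    simp [Torus.divergence, Torus.partialDeriv, Torus.lineDeriv]
  integral_inner_convect_eq_neg (isSmooth_const V) hV ha hb

omit [DecidableEq d] in
/-- `∫ ⟪a x, Da(x) V⟫ = 0` for smooth `a` on `T^d` (`⟪a, ∂_V a⟫ = ½ ∂_V ‖a‖²`; here: the pairing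
equals minus itself by `integral_inner_fderiv_const_eq_neg`). [folklore] -/
theorem integral_inner_self_fderiv_const {a : UnitAddTorus d → EuclideanSpace ℝ d}
    (ha : IsSmooth a) (V : EuclideanSpace ℝ d) : ∫ x, ⟪a x, Torus.fderiv a x V⟫_ℝ = 0 := by
  classical
  have h := integral_inner_fderiv_const_eq_neg ha ha V
  rw [integral_congr_ae (ae_of_all _ fun x => real_inner_comm (a x) (Torus.fderiv a x V))] at h
  linarith

end DriftWeak

open DriftWeak

/-! ## §2 The stub -/

/-- **stub_driftWeakOfClassical** (registered sub-goal of lead c15, wave 3).  A classical steady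
state `u` of `NS_ν(f)` of ANY mean `m = ∫ u` (`f` smooth): its mean-zero part is carried by a
drifted steady weak solution `W ∈ V` with drift `m`,
`⟨F_{ν,f}(W), φ⟩ + ∫ ⟪Dφ(x) m, W(x)⟫ dx = 0` for all `φ ∈ 𝒱`, and the budgets are
`meanEnergy = ‖m‖² + ‖W‖²`, `meanDissipation = ν‖∇W‖² = (W, f)`.  (Split `u = m + w`; `w` is a
classical mean-zero steady state for the drifted force `f − Dw·m`; classical ⇒ weak; the drift is
moved onto the test field by the antisymmetry of the trilinear form; energy equation.) [folklore] -/
theorem stub_driftWeakOfClassical : ∀ (ν : ℝ) (f u : UnitAddTorus (Fin 3) → EuclideanSpace ℝ (Fin 3))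
    (p : UnitAddTorus (Fin 3) → ℝ), 0 < ν → IsSmooth f → Torus.IsSteadyNSState ν f u p →
    ∃ W : energySpace (Fin 3), W.1 ∈ energySpaceV (Fin 3) ∧
      (∀ w : UnitAddTorus (Fin 3) → EuclideanSpace ℝ (Fin 3), IsSmooth w → IsDivFree w → HasZeroMean w →
        Torus.nsGeneratorPairing ν f W w +
          ∫ x, ⟪Torus.fderiv w x (∫ y, u y), (W.1 : UnitAddTorus (Fin 3) → EuclideanSpace ℝ (Fin 3)) x⟫_ℝ = 0) ∧
      meanEnergy (fun _ : ℝ => u) = ‖∫ y, u y‖ ^ 2 + ‖W‖ ^ 2 ∧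
      meanDissipation ν (fun _ : ℝ => u) = ν * (eGradNormSq (W.1 : UnitAddTorus (Fin 3) → EuclideanSpace ℝ (Fin 3))).toReal ∧
      meanDissipation ν (fun _ : ℝ => u) = Torus.pairing W.1 f := by
  intro ν f u p _ hf hst
  -- the classical data at time `0`
  have hu : IsSmooth u := hst.smooth_velocity.isSmooth_slice (mem_univ 0)
  have hp : IsSmooth p := hst.smooth_pressure.isSmooth_slice (mem_univ 0)
  have hdiv : IsDivFree u := hst.divFree 0 (mem_univ 0)
  have hmom : ∀ y, ν • laplacian u y - convect u u y + f y = Torus.gradient p y := fun y => by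
    have h := hst.momentum 0 (mem_univ 0) y
    have h0 : Torus.timeDerivWithin Set.univ (fun _ : ℝ => u) 0 y = 0 := by
      simp [Torus.timeDerivWithin]
    rw [h0, zero_add] at h
    rw [h]
    abel
  -- the drift `m = ∫ u` and the mean-zero part `w = u - m`
  generalize hm : (∫ y, u y) = m
  set w : UnitAddTorus (Fin 3) → EuclideanSpace ℝ (Fin 3) := fun x => u x - m
  have hw : IsSmooth w := hu.sub (isSmooth_const m)
  have hwd : IsDivFree w := WindySteadyLimit.isDivFree_sub_const hu hdiv m
  have hw0 : HasZeroMean w := by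
    have h := WindySteadyLimit.hasZeroMean_sub_integral hu.integrable
    rw [hm] at h
    exact h
  -- the drifted smooth force `g = f - Dw·m`; `w` is a classical steady state of `NS_ν(g)` with
  -- the same pressure
  set g : UnitAddTorus (Fin 3) → EuclideanSpace ℝ (Fin 3) := fun x => f x - Torus.fderiv w x m
  have hDw : IsSmooth (fun x => Torus.fderiv w x m) := (isSmooth_const m).convect hw
  have hg : IsSmooth g := hf.sub hDw
  have hmomw : ∀ x, ν • laplacian w x - convect w w x + g x = Torus.gradient p x := fun x => by
    have h1 : laplacian w x = laplacian u x := WindySteadyLimit.laplacian_sub_const hu m x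
    have h2 : convect w w x = convect u u x - Torus.fderiv w x m := by
      show Torus.fderiv w x (u x - m) = Torus.fderiv u x (u x) - Torus.fderiv w x m
      rw [map_sub, fderiv_sub_const_field]
    rw [h1, h2, ← hmom x]
    show ν • laplacian u x - (convect u u x - Torus.fderiv w x m) + (f x - Torus.fderiv w x m) = _
    abel
  have htest : ∀ φ : UnitAddTorus (Fin 3) → EuclideanSpace ℝ (Fin 3), IsSmooth φ → IsDivFree φ →
      HasZeroMean φ → ∫ x, ⟪ν • Torus.laplacian w x - Torus.convect w w x + g x, φ x⟫_ℝ = 0 :=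
    fun φ hφ hφd _ => by
      simp_rw [hmomw]
      exact integral_inner_gradient_eq_zero_of_isDivFree hφ hp hφd
  -- classical ⇒ weak for `(ν, g, w)`
  obtain ⟨W, hae, hV, hWg⟩ :=
    KolmogorovFloorEnsembleCeiling.Negative.exists_steadyState_of_classical hg hw hwd hw0 htest
  -- `‖W‖² = ∫ ‖w‖²` and `‖∇u‖² = ‖∇(m + w)‖² = ‖∇w‖² = ‖∇W‖²` (the wind carries no enstrophy)
  have hnormW : ∫ y, ‖u y - m‖ ^ 2 = ‖W‖ ^ 2 := by
    rw [Submodule.coe_norm, ← integral_norm_sq_coe_eq]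
    exact integral_congr_ae (by filter_upwards [hae] with y hy; rw [hy])
  have hgradW :
      eGradNormSq u = eGradNormSq (W.1 : UnitAddTorus (Fin 3) → EuclideanSpace ℝ (Fin 3)) := by
    rw [eGradNormSq_congr_ae_field hae, ← WindySteadyLimit.eGradNormSq_const_add m hw.integrable]
    exact congrArg eGradNormSq (funext fun x => show u x = m + (u x - m) by abel)
  -- the budgets of the constant-in-time curve `u`
  have hE : meanEnergy (fun _ : ℝ => u) = ‖m‖ ^ 2 + ‖W‖ ^ 2 := by
    rw [meanEnergy_eq_of_periodic (τ := 1) (fun _ => rfl) one_pos]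
    have h1 : ∫ y, ‖u y‖ ^ 2 = ‖m‖ ^ 2 + ‖W‖ ^ 2 := by
      rw [integral_norm_sq_eq_of_mean hu hm, hnormW]
    simp [h1]
  have hD : meanDissipation ν (fun _ : ℝ => u) =
      ν * (eGradNormSq (W.1 : UnitAddTorus (Fin 3) → EuclideanSpace ℝ (Fin 3))).toReal := by
    rw [meanDissipation_eq_of_periodic (τ := 1) (fun _ => rfl) one_pos, hgradW]
    simp
  -- the energy equation for `NS_ν(g)`, and `(W, g) = (W, f)` (the drift does no work on `w`)
  have hWf : ν * (eGradNormSq (W.1 : UnitAddTorus (Fin 3) → EuclideanSpace ℝ (Fin 3))).toReal =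
      Torus.pairing W.1 f := by
    rw [IsSteadyWeakSolution.energy_eq' (by simp) (hg.memLp 2) hV hWg]
    have h1 : Torus.pairing W.1 g = ∫ x, ⟪w x, g x⟫_ℝ :=
      integral_congr_ae (by filter_upwards [hae] with x hx; rw [hx])
    have h2 : Torus.pairing W.1 f = ∫ x, ⟪w x, f x⟫_ℝ :=
      integral_congr_ae (by filter_upwards [hae] with x hx; rw [hx])
    have h3 : ∫ x, ⟪w x, g x⟫_ℝ = (∫ x, ⟪w x, f x⟫_ℝ) - ∫ x, ⟪w x, Torus.fderiv w x m⟫_ℝ := by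
      rw [← integral_sub (hw.inner hf).integrable (hw.inner hDw).integrable]
      exact integral_congr_ae (ae_of_all _ fun x => inner_sub_right _ _ _)
    rw [h1, h2, h3, integral_inner_self_fderiv_const hw, sub_zero]
  refine ⟨W, hV, fun φ hφ hφd hφ0 => ?_, hE, hD, hD.trans hWf⟩
  -- the drifted weak formulation: move the drift part of `g` onto the test field
  have h := hWg φ hφ hφd hφ0
  have hgφ : ∫ x, ⟪g x, φ x⟫_ℝ = (∫ x, ⟪f x, φ x⟫_ℝ) +
      ∫ x, ⟪Torus.fderiv φ x m, (W.1 : UnitAddTorus (Fin 3) → EuclideanSpace ℝ (Fin 3)) x⟫_ℝ := by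
    have h1 : ∫ x, ⟪g x, φ x⟫_ℝ = (∫ x, ⟪f x, φ x⟫_ℝ) - ∫ x, ⟪Torus.fderiv w x m, φ x⟫_ℝ := by
      rw [← integral_sub (hf.inner hφ).integrable (hDw.inner hφ).integrable]
      exact integral_congr_ae (ae_of_all _ fun x => inner_sub_left _ _ _)
    have h2 : ∫ x, ⟪Torus.fderiv w x m, φ x⟫_ℝ =
        -∫ x, ⟪Torus.fderiv φ x m,
          (W.1 : UnitAddTorus (Fin 3) → EuclideanSpace ℝ (Fin 3)) x⟫_ℝ := by
      rw [integral_inner_fderiv_const_eq_neg hw hφ]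
      refine congrArg Neg.neg (integral_congr_ae ?_)
      filter_upwards [hae] with x hx
      rw [hx]
      exact real_inner_comm _ _
    rw [h1, h2, sub_neg_eq_add]
  unfold Torus.nsGeneratorPairing at h ⊢
  rw [hgφ] at h
  linear_combination h

end Summit.AnomalousDissipation.AnomalousDissipation.Theorems.RobustLoudUpgrade.Category

end
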